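import Literature.MathematicalPhysics.QuantumFieldTheory.Balaban1983to89.B15Prop1Thm1RowsOfExistsUnique
import Literature.MathematicalPhysics.QuantumFieldTheory.Balaban1983to89.Node00.CriticalOnFibreB

/-!
# `Balaban1983to89.B15Prop1Thm1RowsOfExistsUniqueAtLengthB` — [Balaban1985Variational] = «[15]», Thm 1 p. 279, (1)–(7) pp. 277–278; [Balaban1988Convergent] = «[III]», (2.1) p. 254,
# (2.12)–(2.13) pp. 256–257, (2.18) p. 257; [Balaban1984PropagatorsII] = «[II]», (2.3) p. 224; [Balaban1989LargeFieldI] = «[IV]», (1.74) p. 192, Prop. 1 p. 194: THE AT-LENGTH ROWS (E) AND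
# (T1@q₀) OF THE (J0′) PRODUCER (`B15Prop1Thm1RowsOfExistsUniqueAtLength`, dag-n12-d ✓) OVER A **BOND-DATUM FAMILY** `bd` — the two [15]-Theorem-1 letters `h15T` ((8)) and `h15EUT`
# (existence ∕ uniqueness) read for minimisers constrained on `bd (k i) s.Ω` ([III] (2.12) over a bond datum), the rows concluded for the (1.74) minimiser constrained on
# `bd (k i) (maxDomT ν.M₁ (Z i))`, with agreement and tower-centrality read on the bonds of `bd`; the (7) rows stay the record's `Sect2.DataSmall7PTop`

Honest framing: statement-level skeleton of published theorems with citation tags; proofs where landed; nothing here is a claim about the Yang–Mills mass gap.  Cell `pub-ymgap`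
(HUMAN RULINGS D-0062 ∕ D-0149), seat `pub-ymgap-dag-n12-c` g34 (R134 seat (a), N12 = [B15], s1, lane owner); count-neutral helper of K1⁹ `stmt-QuantumFields-27364`
(`--kind proof --supports`); N12 NOT discharged; one finite 𝕋⁴ programme at fixed ε; nothing continuum ∕ ℝ⁴ ∕ OS ∕ mass-gap ∕ Clay.  THEOREMS ONLY (0 `def`, 0 `instance`, 0 `sorry`).

HONESTY GUARD (director-ym №338 (5)).  PURELY ADDITIVE: the (b)-instance edition stays landed and true on its own text; this is its parametrisation in the determining datum ONLY (FLAG №16 ∕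
LOCATE-HSEAM 5d3298b8d191f169; (E1) variant (iii-b); the lane's memo `N12-REATTACHMENT-DESIGN-2026-08-30.md` §3 step 4, second head): `IsMinimizer … (genSet s.Ω (k i))` ↦ `IsMinimizerB …
(bd (k i) s.Ω)` and `bondsOf (genSet s.Ω (k i) j)` ↦ `bd (k i) s.Ω j` in the letters, `IsMinimizer ∕ AgreeOn ∕ bondsOf` at `Bj ν.M₁ (Z i) (k i)` ↦ `IsMinimizerB ∕ AgreeOnB ∕ ·` at
`bd (k i) (maxDomT ν.M₁ (Z i))` in the conclusions; proofs VERBATIM but `genSet_congr ↦ hbdΩ` (the family reads levels `1…k` only: `bondsDet_genSet_congr ∕ lamBondsSeq_congr` of the lane's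
`B15Prop1MinimiserClassAtDatumScaleAtLengthB` §0), w1's order lemmas ↦ their `IsMinimizerB` editions of §0 below, and `isMinimizer_of_mem_of_subset ↦` F0b `Node00.IsMinimizerB.of_subset_of_mem`.
At `bd := B15Sect1Instances.genSetDatumP` the statement IS the parent's (F0a `isMinimizer_iff_isMinimizerB`, `agreeOn_iff_agreeOnB`, `Iff.rfl`); at `bd := lamDatumP` its letters are the
bodies of K0's `VariationalThm1RegSepCoP7MGB F 2 A‴ (lamDatum F) …` and the lane's `B11Thm1ExistsUniqueTokensGB.VariationalThm1EUSepCoP7MGB F 2 A‴ (lamDatum F) …` at the length `k i` with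
the record's (7) (the print plug `B11Thm1ExistsUniqueTokensGBPrint` supplies that reading from the print-(7) names).

CONTENTS.  §0 `isMinimizerB_of_le_of_isMinimizerB` · `wilsonAction4_eq_of_isMinimizerB_of_subset` · `isMinimizerB_of_isMinimizerB_of_subset` · ★ `thm1RowB_of_existsUnique` (w1's order
bookkeeping over a bond datum); §1 `eta_pos` (private); §2 ★★★ `thm1Rows_atZ_of_thm1TorusClass_existsUnique_atLengthB`.

HONEST SCOPE.  Bookkeeping by name over landed modules; [15] Theorem 1 ((8), existence ∕ uniqueness at the instance's length `k i ≥ 1`, over a bond datum) stays DISPLAYED, nothing of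
Bałaban's asserted; count-neutral; N12 NOT discharged; K0⁷ ∕ K1⁹ NOT closed; counts unmoved; R4 closes only the conditional finite-𝕋⁴ rung `BalabanLadder.UV` — no summit statement is
proved here and NOT the Yang–Mills mass gap (Clay); nothing continuum ∕ ℝ⁴ ∕ OS.
-/

noncomputable section

open Set

namespace Literature.MathematicalPhysics.QuantumFieldTheory.Balaban1983to89.B15Prop1Thm1RowsOfExistsUniqueAtLengthB

open T4Continuum B15DeterminingSets GaugeField B15Prop1Carrier B8Eq17ClassAkV1 BlockAveraging
open B14.Eq22Determines (blockIter IsBlockUnion)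
open Literature.MathematicalPhysics.QuantumFieldTheory.BalabanImbrieJaffe1984to88.BIJ85Eq453GaugeField (qsstarGIter0)
open B15Prop1DatumSmall7AtZSequence B15Prop1Thm1GeneralFormAtZSequence B15Prop1Thm1GeneralFormShapes
open B16Sect1Backgrounds (toMS)
open B15Prop1Thm1RowsOfExistsUnique
open B15DeterminingSetsB (BDetSet IsMinimizerB AgreeOnB)

/-! ## §1  `η_j > 0` -/

section Eta

variable {F : T4Family}

/-! ## §0  Order bookkeeping on `IsMinimizerB` (w1's §1 of `B15Prop1Thm1RowsOfExistsUnique` over a bond datum) -/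

section OrderB

variable {P : Params} {G : Type*} [GaugeGroup G] (av : ∀ j, Averaging P j G)

/-- A constrained configuration of the class whose action does not exceed a minimiser's is itself a minimiser (bond datum). [cite: Balaban1985Variational, (5)–(6) p.278 (bookkeeping)] -/
theorem isMinimizerB_of_le_of_isMinimizerB {reg₀ : Set (GaugeField P 0 G)} {𝔅 : BDetSet P} {W : MSField P G} {U U₁ : GaugeField P 0 G}
    (h : IsMinimizerB av reg₀ 𝔅 W U₁) (hU : U ∈ reg₀) (hUW : AgreeOnB 𝔅 (avgFamily av U) W) (hle : wilsonAction4 U ≤ wilsonAction4 U₁) :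
    IsMinimizerB av reg₀ 𝔅 W U :=
  ⟨hU, hUW, fun U' hU' hW' => hle.trans (h.2.2 U' hU' hW')⟩

/-- If the larger class `reg₀ ⊇ reg` has a minimiser INSIDE `reg`, every minimiser over `reg` has the same action (bond datum). [cite: Balaban1985Variational, Thm 1 (8) p.279 (bookkeeping)] -/
theorem wilsonAction4_eq_of_isMinimizerB_of_subset {reg reg₀ : Set (GaugeField P 0 G)} {𝔅 : BDetSet P} {W : MSField P G} {U₀ U₁ : GaugeField P 0 G}
    (h₀ : IsMinimizerB av reg 𝔅 W U₀) (h₁ : IsMinimizerB av reg₀ 𝔅 W U₁) (hsub : reg ⊆ reg₀) (hU₁ : U₁ ∈ reg) :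
    wilsonAction4 U₀ = wilsonAction4 U₁ :=
  le_antisymm (h₀.2.2 U₁ hU₁ h₁.2.1) (h₁.2.2 U₀ (hsub h₀.1) h₀.2.1)

/-- Under the same hypothesis every minimiser over the smaller class `reg` is a minimiser over the larger class `reg₀` (bond datum). [cite: Balaban1985Variational, Thm 1 (8) p.279 (bookkeeping)] -/
theorem isMinimizerB_of_isMinimizerB_of_subset {reg reg₀ : Set (GaugeField P 0 G)} {𝔅 : BDetSet P} {W : MSField P G} {U₀ U₁ : GaugeField P 0 G}
    (h₀ : IsMinimizerB av reg 𝔅 W U₀) (h₁ : IsMinimizerB av reg₀ 𝔅 W U₁) (hsub : reg ⊆ reg₀) (hU₁ : U₁ ∈ reg) :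
    IsMinimizerB av reg₀ 𝔅 W U₀ :=
  isMinimizerB_of_le_of_isMinimizerB av h₁ (hsub h₀.1) h₀.2.1 (wilsonAction4_eq_of_isMinimizerB_of_subset av h₀ h₁ hsub hU₁).le

/-- ★ **THE THEOREM-1 ROW (T1@q₀) FROM AN EXISTENCE ∕ UNIQUENESS PAIR ON A LARGER CLASS, OVER A BOND DATUM** (twin of w1's `thm1Row_of_existsUnique`). [cite: Balaban1985Variational, Thm 1 p.279; Balaban1988Convergent, (2.12) p.256] -/
theorem thm1RowB_of_existsUnique {reg reg' reg₀ : Set (GaugeField P 0 G)} {𝔅 : BDetSet P} {W : MSField P G}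
    (Rel : GaugeField P 0 G → GaugeField P 0 G → Prop) (hsub : reg ⊆ reg₀) (hsub' : reg' ⊆ reg₀)
    (hex : ∃ U₁, IsMinimizerB av reg₀ 𝔅 W U₁ ∧ U₁ ∈ reg)
    (huniq : ∀ U₁ U₂, IsMinimizerB av reg₀ 𝔅 W U₁ → IsMinimizerB av reg₀ 𝔅 W U₂ → Rel U₁ U₂)
    {U₀ : GaugeField P 0 G} (h₀ : IsMinimizerB av reg 𝔅 W U₀) :
    ∀ U ∈ reg', AgreeOnB 𝔅 (avgFamily av U) W → wilsonAction4 U ≤ wilsonAction4 U₀ → Rel U U₀ := by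
  intro U hU hUW hle
  obtain ⟨U₁, h₁, hU₁⟩ := hex
  have h₀' : IsMinimizerB av reg₀ 𝔅 W U₀ := isMinimizerB_of_isMinimizerB_of_subset av h₀ h₁ hsub hU₁
  exact huniq U U₀ (isMinimizerB_of_le_of_isMinimizerB av h₀' (hsub' hU) hUW hle) h₀'

end OrderB

/-- `0 < η_j` (`η_j = L^{−j}`, `L ≥ 1`). [folklore] -/
private theorem eta_pos (K j : ℕ) : 0 < (F.P K).eta j := by
  have hL : (0 : ℝ) < (F.P K).L := by exact_mod_cast (F.P K).L_pos
  unfold Params.eta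
  positivity

end Eta

/-! ## §2  At print's (1.74) object: the rows (E) and (T1@q₀) for EVERY base field of the strict guard, from the two [15] letters READ AT THE INSTANCES' OWN LENGTHS `k i` (the lane's `_pos` §2, verbatim but for the two letter binders and their two calls) -/

section AtZ

open Classical
open Metric
open B14DomainGeom (IsUnionOfCubes)
open B15Eq112TorusCover (cover)
open B14.Eq213MaximalDomains (side)
open B14.Eq213DetSet B15Sect1Instances B16Sect1Wilson B16Sect1Backgrounds
open T4CubeChartGnomonic (SU2)
open T4AxialGaugeSmallField (castSite boxPlaqs)
open B15Extension193 (extend)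
open B15ShellGauge193 (shellGauge)
open B15ShellGauge193Local (dist1_plaqHol_extend_shellGauge_le)

/-- ★★★ **BOND-DATUM EDITION (the letters and the rows read the determining datum `bd (k i) ·`; everything else as in dag-n12-d's at-length edition). THE ROWS (E) AND (T1@q₀) OF «(J0′) OF RECORD» FOR EVERY BASE FIELD OF THE STRICT GUARD, FROM THE TWO [15] LETTERS READ AT EACH INSTANCE's OWN LENGTH — AT-LENGTH EDITION** of the lane's
`B15Prop1Thm1RowsOfExistsUniquePos.thm1Rows_atZ_of_thm1TorusClass_existsUnique_pos`: K0⁷'s (8)-letter `h15T` ([15] Thm 1 (R) over NODE 00's torus class of `LʲM₁`-cube unions at `(ν, Kt)`) and the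
EXISTENCE ∕ UNIQUENESS letter `h15EUT` (conclusion «∃ minimiser over class (6) at `ε₀`» ∧ «any two minimisers differ by a gauge with equal, central scale-`j` images at the two ends of every
constrained bond»), EACH STATED PER INSTANCE `i` AT THE LENGTH `k i` ONLY (`∀ i, ∀ s : Seq … (k i), …`; the `_pos` bodies with `k'` read as `k i`; the rows `k i ≤ m + K`, `0 < k i`,
`L^{k i}M₁ ∣ sitesPerDir 0` are the displayed instance rows `hk` ∕ `hk0` ∕ `hdiv`) — so that a producer guarded in the length (the K0 road's grid-guarded (8)-token
`Node00.VariationalThm1RegSepCoP7MG F 2 A‴ B₃ a₀ a₁`) serves exactly the instances passing its guard.  Per instance `i` of the knit (`Z, Λ, k, lo, hi, ext`: the geometry rows of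
`nearValue_letter_of_thm1Guarded` VERBATIM), for every `0 < ε` with `(c_E+1)ε ≤ a₁`, every class tolerance `εr ≥ B₃(c_E+1)ε`, every `ε₀` with `εr < ε₀ ≤ a₀`, and every base field `V_k` with
`PlaqSmallOn (plaqsInside (pts k (Z ∩ Λᶜ))) ε V_k`:
(E) `∃ U₀, IsMinimizer (M˙) (U_k({Ω_j(Z)}, εr)) (𝐁_k(Z)) (M˙(Q_k^{s*}(ext V_k))) U₀` — U2 :171–173 VERBATIM at `ν⟨εreg := εr⟩` — and, for EVERY such minimiser `U₀`,
(T1@q₀) over `reg' := closure (U_k({Ω_j(Z)}, εr))` — dag-n12-d (A″) :196–200 VERBATIM.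
Proof: the lane's `_pos` proof verbatim but for the two letter calls. [cite: Balaban1985Variational, (1) p.277, (2),(3),(5),(6),(7) p.278, Thm 1 (8) p.279; Balaban1988Convergent, (2.1) p.254, p.255, (2.12)–(2.13) pp.256–257, (2.18) p.257; Balaban1989LargeFieldI, (1.74) p.192, p.193 ll.14–20, Prop. 1 p.194; Balaban1989LargeFieldII, (1.12)–(1.13) p.359; Balaban1985RegularSpaces, (1.3)–(1.9) p.77] -/
theorem thm1Rows_atZ_of_thm1TorusClass_existsUnique_atLengthB {F : T4Family} (ν : Node00.Stage7Numerics) (Kt : ℕ) (hd3 : 3 ≤ (F.P Kt).d) {ι : Type}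
    (Z Λ : ι → Set (Site (F.P Kt) 0)) (k : ι → ℕ) (hk0 : ∀ i, 0 < k i) (hk : ∀ i, k i ≤ (F.P Kt).m + (F.P Kt).K)
    (lo hi : ι → Fin (F.P Kt).d → ℤ) (n : ι → ℕ) (hn : ∀ i κ, hi i κ ≤ lo i κ + n i)
    (hbox : ∀ i, pts (k i) (Λ i) = (castSite '' Set.Icc (lo i) (hi i) : Set (Site (F.P Kt) (k i))))
    (hZ : ∀ i, (boxPlaqs (lo i - 1) (hi i + 1) : Set (Plaq (F.P Kt) (k i))) ⊆ plaqsInside (pts (k i) (Z i)))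
    (hN5 : ∀ i κ, ((hi i κ - lo i κ + 1).toNat : ℤ) + 5 < (F.P Kt).sitesPerDir (k i))
    (ext : ∀ i, GaugeField (F.P Kt) (k i) SU2 → GaugeField (F.P Kt) (k i) SU2)
    (hext : ∀ i Vk, ext i Vk = extend (pts (k i) (Λ i)) (shellGauge Vk (lo i) (hi i)) Vk)
    (hlohi : ∀ i, lo i ≤ hi i)
    -- (Gᵃ) geometry of `Z`: a union of `k`-blocks; print's `M₁ ≥ 2` and the torus divisibility of the `LʲM₁`-cube partitions
    (hZblk : ∀ i, IsBlockUnion (k i) (Z i))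
    (hM2 : 2 ≤ ν.M₁) (hdiv : ∀ i, side (F.P Kt).L ν.M₁ (k i) ∣ (F.P Kt).sitesPerDir 0)
    -- the BOND-DATUM FAMILY (reading (b): `B15Sect1Instances.genSetDatumP`; print's [II] (2.3): `lamDatumP`), reading the levels `1…k` of its sequence only
    (bd : ℕ → (ℕ → Set (Site (F.P Kt) 0)) → BDetSet (F.P Kt)) (hbdΩ : ∀ (i : ι) (Ω Ω' : ℕ → Set (Site (F.P Kt) 0)), (∀ j, 1 ≤ j → j ≤ k i → Ω j = Ω' j) → bd (k i) Ω = bd (k i) Ω')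
    -- bookkeeping constants
    {cE B₃ a₀ a₁ : ℝ} (hcE0 : 0 ≤ cE) (hcE : ∀ i, 12 * ((F.P Kt).d : ℝ) * ((n i : ℝ) + 2) ^ 2 ≤ cE)
    -- [15] THEOREM 1 (R) = (8) OVER NODE 00's TORUS CLASS (shape (C)), READ AT EACH INSTANCE's OWN LENGTH `k i` (served by the K0 road's grid-guarded (8)-token
    -- `Node00.VariationalThm1RegSepCoP7MG F 2 A‴ B₃ a₀ a₁` at instances passing the guard — dag-n12-d `BalabanUVNodesN12Thm1LettersAtLengthOfK0GridG`; by the `_pos` letter at every instance)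
    (h15T : ∀ (i : ι) (s : B14.Eq218Concrete.Seq (fun n : ℕ => Node00.unionsOfCubes (F.P Kt) (side (F.P Kt).L ν.M₁ n)) (k i)),
      Node00.Sect2.SeqSeparated ν.M₁ s → 0 < ν.M₁ →
      ∀ (ε₀ : ℝ) (δ : ℕ → ℝ), (∀ j, j ≤ k i → 0 < δ j ∧ δ j ≤ a₁ ∧ B₃ * δ j ≤ ε₀) → (∀ j, j < k i → δ j ≤ 2 * δ (j + 1)) →
      (∀ j, j < k i → δ (j + 1) ≤ 2 * δ j) → ε₀ ≤ a₀ →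
      ∀ W : MSField (F.P Kt) SU2,
        Node00.Sect2.DataSmall7PTop (Node00.avOfRecord F 2 Kt) s.Ω (Node00.suppDomOfRecord F ν Kt s.Ω) (k i) δ W →
        ∀ U₀ : GaugeField (F.P Kt) 0 SU2, IsMinimizerB (Node00.avOfRecord F 2 Kt)
            {U | (∀ j, j ≤ k i → PlaqSmallOn (Node00.Sect2.omegaPlaqsTop s.Ω (Node00.suppDomOfRecord F ν Kt s.Ω) j)
                (ε₀ * (F.P Kt).eta j ^ 2) U) ∧
              Node00.Sect2.CoDivClassOnTop s.Ω (Node00.suppDomOfRecord F ν Kt s.Ω) (k i) ε₀ U}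
            (bd (k i) s.Ω) W U₀ →
          (∀ j, j ≤ k i → PlaqSmallOn (Node00.Sect2.omegaPlaqsTop s.Ω (Node00.suppDomOfRecord F ν Kt s.Ω) j)
              (B₃ * δ j * (F.P Kt).eta j ^ 2) U₀) ∧
            ∀ j, j ≤ k i → Node00.Sect2.CoDivSmallOn (Node00.Sect2.omegaBondsTop s.Ω (Node00.suppDomOfRecord F ν Kt s.Ω) j)
              (B₃ * δ j * (F.P Kt).eta j ^ 3) U₀)
    -- [15] THEOREM 1, EXISTENCE OF THE MINIMAL ORBIT ∕ UNIQUENESS MODULO TOWER-CENTRAL GAUGES OVER NODE 00's TORUS CLASS, READ AT EACH INSTANCE's OWN LENGTH `k i ≥ 1` (no producer in the tree)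
    (h15EUT : ∀ (i : ι) (s : B14.Eq218Concrete.Seq (fun n : ℕ => Node00.unionsOfCubes (F.P Kt) (side (F.P Kt).L ν.M₁ n)) (k i)),
      Node00.Sect2.SeqSeparated ν.M₁ s → 0 < ν.M₁ →
      ∀ (ε₀ : ℝ) (δ : ℕ → ℝ), (∀ j, j ≤ k i → 0 < δ j ∧ δ j ≤ a₁ ∧ B₃ * δ j ≤ ε₀) → (∀ j, j < k i → δ j ≤ 2 * δ (j + 1)) →
      (∀ j, j < k i → δ (j + 1) ≤ 2 * δ j) → ε₀ ≤ a₀ →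
      ∀ W : MSField (F.P Kt) SU2,
        Node00.Sect2.DataSmall7PTop (Node00.avOfRecord F 2 Kt) s.Ω (Node00.suppDomOfRecord F ν Kt s.Ω) (k i) δ W →
        (∃ U₀ : GaugeField (F.P Kt) 0 SU2, IsMinimizerB (Node00.avOfRecord F 2 Kt)
            {U | (∀ j, j ≤ k i → PlaqSmallOn (Node00.Sect2.omegaPlaqsTop s.Ω (Node00.suppDomOfRecord F ν Kt s.Ω) j)
                (ε₀ * (F.P Kt).eta j ^ 2) U) ∧
              Node00.Sect2.CoDivClassOnTop s.Ω (Node00.suppDomOfRecord F ν Kt s.Ω) (k i) ε₀ U}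
            (bd (k i) s.Ω) W U₀) ∧
        ∀ U₁ U₂ : GaugeField (F.P Kt) 0 SU2,
          IsMinimizerB (Node00.avOfRecord F 2 Kt)
            {U | (∀ j, j ≤ k i → PlaqSmallOn (Node00.Sect2.omegaPlaqsTop s.Ω (Node00.suppDomOfRecord F ν Kt s.Ω) j)
                (ε₀ * (F.P Kt).eta j ^ 2) U) ∧
              Node00.Sect2.CoDivClassOnTop s.Ω (Node00.suppDomOfRecord F ν Kt s.Ω) (k i) ε₀ U}
            (bd (k i) s.Ω) W U₁ →
          IsMinimizerB (Node00.avOfRecord F 2 Kt)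
            {U | (∀ j, j ≤ k i → PlaqSmallOn (Node00.Sect2.omegaPlaqsTop s.Ω (Node00.suppDomOfRecord F ν Kt s.Ω) j)
                (ε₀ * (F.P Kt).eta j ^ 2) U) ∧
              Node00.Sect2.CoDivClassOnTop s.Ω (Node00.suppDomOfRecord F ν Kt s.Ω) (k i) ε₀ U}
            (bd (k i) s.Ω) W U₂ →
          ∃ u : GaugeTransf (F.P Kt) 0 SU2,
            (∀ j, j ≤ k i → ∀ b ∈ bd (k i) s.Ω j, toMS u j b.src = toMS u j b.tgt ∧ ∀ g : SU2, toMS u j b.src * g = g * toMS u j b.src) ∧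
              gaugeAct u U₁ = U₂) :
    ∀ i (εr ε₀ ε : ℝ) (Vk : GaugeField (F.P Kt) (k i) SU2), 0 < ε → (cE + 1) * ε ≤ a₁ → B₃ * ((cE + 1) * ε) ≤ εr → εr < ε₀ → ε₀ ≤ a₀ →
      PlaqSmallOn (plaqsInside (pts (k i) (Z i ∩ (Λ i)ᶜ))) ε Vk →
      (∃ U₀ : GaugeField (F.P Kt) 0 SU2,
          IsMinimizerB (Node00.avOfRecord F 2 Kt) (Node00.regMSCoPOfRecord F 2 {ν with εreg := εr} Kt (k i) (maxDomT ν.M₁ (Z i))) (bd (k i) (maxDomT ν.M₁ (Z i)))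
            (avgFamily (Node00.avOfRecord F 2 Kt) (qsstarGIter0 (k i) (ext i Vk))) U₀) ∧
      ∀ U₀ : GaugeField (F.P Kt) 0 SU2,
        IsMinimizerB (Node00.avOfRecord F 2 Kt) (Node00.regMSCoPOfRecord F 2 {ν with εreg := εr} Kt (k i) (maxDomT ν.M₁ (Z i))) (bd (k i) (maxDomT ν.M₁ (Z i)))
            (avgFamily (Node00.avOfRecord F 2 Kt) (qsstarGIter0 (k i) (ext i Vk))) U₀ →
        ∀ U ∈ closure (Node00.regMSCoPOfRecord F 2 {ν with εreg := εr} Kt (k i) (maxDomT ν.M₁ (Z i))),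
          AgreeOnB (bd (k i) (maxDomT ν.M₁ (Z i))) (avgFamily (Node00.avOfRecord F 2 Kt) U) (avgFamily (Node00.avOfRecord F 2 Kt) (qsstarGIter0 (k i) (ext i Vk))) →
          wilsonAction4 U ≤ wilsonAction4 U₀ →
            ∃ u : GaugeTransf (F.P Kt) 0 SU2,
              (∀ j, j ≤ k i → ∀ b ∈ bd (k i) (maxDomT ν.M₁ (Z i)) j, toMS u j b.src = toMS u j b.tgt ∧ ∀ g : SU2, toMS u j b.src * g = g * toMS u j b.src) ∧
                gaugeAct u U = U₀ := by
  intro i εr ε₀ ε Vk hε hεa₁ hεr hr₀ ha₀ hreg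
  have hd : 2 ≤ (F.P Kt).d := by omega
  have hM : 1 ≤ ν.M₁ := le_trans one_le_two hM2
  have hki : 1 ≤ k i := hk0 i
  -- `Z`'s maximal sequence as a separated (2.18) index, with print's cube letters, re-indexed over NODE 00's torus class
  obtain ⟨s, hsΩ, -, hscube, hsep⟩ := exists_seq_maxDomT hM (Z i) (hdiv i)
  obtain ⟨s', hΩ'⟩ := exists_seq_torusClass_of_cubeLetters hM s hscube
  have hsep' : Node00.Sect2.SeqSeparated ν.M₁ s' := (seqSeparated_iff_of_Ω_eq ν.M₁ hΩ').2 hsep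
  have hw1 : s.Ω 1 = maxDomT ν.M₁ (Z i) 1 := hsΩ 1 le_rfl hki
  -- (a) the p. 193 extension is `(cE+1)ε`-small on the `k`-plaquettes inside `Z`
  have hN3 : ∀ κ, hi i κ - lo i κ + 3 < ((F.P Kt).sitesPerDir (k i) : ℤ) := fun κ => by
    have h5 := hN5 i κ
    have hle : lo i κ ≤ hi i κ := hlohi i κ
    rw [Int.toNat_of_nonneg (by linarith)] at h5
    linarith
  have hδ₀ : 0 < (cE + 1) * ε := by positivity
  have hV : PlaqSmallOn (plaqsInside (pts (k i) (Z i))) ((cE + 1) * ε) (ext i Vk) := by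
    intro p hp
    rw [hext]
    have h := (dist1_plaqHol_extend_shellGauge_le hd3 (hlohi i) (hn i) hN3 (hbox i) (hZ i) hε hreg).1 p hp
    calc dist1 (plaqHol (extend (pts (k i) (Λ i)) (shellGauge Vk (lo i) (hi i)) Vk) p)
        ≤ 12 * (F.P Kt).d * (n i + 2) ^ 2 * ε := h
      _ ≤ cE * ε := mul_le_mul_of_nonneg_right (hcE i) hε.le
      _ < (cE + 1) * ε := by nlinarith
  -- (b) print's (7) for the datum ALONG THE INDEX `s.Ω`
  have h0 : Node00.Sect2.printedPlaqsTop s.Ω (Node00.suppDomOfRecord F ν Kt s.Ω) (k i) ⊆ plaqsInside (Z i) := by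
    rw [printedPlaqsTop_congr hki hsΩ, Node00.suppDomOfRecord_congr (F := F) ν Kt hw1]
    exact printedPlaqsTop_maxDomT_subset_plaqsInside hM (hdiv i) hki (k i)
  have hsucc : ∀ m, m + 1 ≤ k i → Node00.Sect2.printedPlaqs s.Ω (k i) (m + 1) ⊆ plaqsInside (pts (m + 1) (Z i)) := by
    intro m hm
    refine (Node00.Sect2.printedPlaqs_subset_plaqsOf _ _ _).trans ?_
    refine (plaqsOf_mono (genSet_subset_pts_of_one_le s.Ω (k i) (Nat.succ_pos m))).trans ?_
    rw [hsΩ (m + 1) (Nat.succ_pos m) hm]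
    exact plaqsOf_pts_maxDomT_subset_plaqsInside hM2 (hdiv i) (Nat.succ_pos m) hm
  have h7 : Node00.Sect2.DataSmall7PTop (Node00.avOfRecord F 2 Kt) s.Ω (Node00.suppDomOfRecord F ν Kt s.Ω) (k i)
      (fun _ => (cE + 1) * ε) (avgFamily (Node00.avOfRecord F 2 Kt) (qsstarGIter0 (k i) (ext i Vk))) :=
    dataSmall7PTop_avgFamily_qsstarGIter0 hd ExpMeanLog.expMeanLogSU T3DescentFibreTower.expMeanLogSU_E_one rfl (hk i)
      s.Ω _ (Z i) (hZblk i) h0 hsucc (fun _ _ => hδ₀) (ext i Vk) (fun _ _ => hV)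
  -- numerics of the thresholds at `ε₀`
  have hnum : ∀ j, j ≤ k i → 0 < (cE + 1) * ε ∧ (cE + 1) * ε ≤ a₁ ∧ B₃ * ((cE + 1) * ε) ≤ ε₀ := fun j _ =>
    ⟨hδ₀, hεa₁, hεr.trans hr₀.le⟩
  -- the two [15] letters AT THIS INSTANCE's LENGTH at the index `s'`, read back at `s.Ω`, applied to the (1.74) datum
  have h8 := h15T i s' hsep' hM
  have hEU := h15EUT i s' hsep' hM
  rw [hΩ'] at h8 hEU
  have h8W := h8 ε₀ (fun _ => (cE + 1) * ε) hnum (fun _ _ => by linarith) (fun _ _ => by linarith) ha₀ _ h7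
  obtain ⟨⟨Ustar, hUstar⟩, huniq⟩ := hEU ε₀ (fun _ => (cE + 1) * ε) hnum (fun _ _ => by linarith) (fun _ _ => by linarith) ha₀ _ h7
  clear h8 hEU
  -- (c) the (1.74) class and determining set at `maxDomT ν.M₁ Z` ARE those at the index `s`; the class literal at `ε₀` IS the class of record at `ν⟨εreg := ε₀⟩`
  rw [setOf_class_eq_regMSCoPOfRecord] at hUstar huniq h8W
  have hreg : ∀ e : ℝ, Node00.regMSCoPOfRecord F 2 {ν with εreg := e} Kt (k i) (maxDomT ν.M₁ (Z i)) =
      Node00.regMSCoPOfRecord F 2 {ν with εreg := e} Kt (k i) s.Ω := fun e => (regMSCoPOfRecord_congr F 2 _ Kt hki hsΩ).symm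
  have hB : bd (k i) (maxDomT ν.M₁ (Z i)) = bd (k i) s.Ω := (hbdΩ i _ _ hsΩ).symm
  -- the `ε₀`-minimiser `U*` is `B₃(cE+1)ε`-regular, hence in the class at `εr`
  have h8U := h8W Ustar hUstar
  have hUr : Ustar ∈ Node00.regMSCoPOfRecord F 2 {ν with εreg := εr} Kt (k i) s.Ω := by
    refine ⟨fun j hj p hp => ((h8U.1 j hj) p hp).trans_le ?_, fun j hj b hb => ((h8U.2 j hj) b hb).trans_le ?_⟩
    · exact mul_le_mul_of_nonneg_right hεr (pow_nonneg (eta_pos Kt j).le 2)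
    · exact mul_le_mul_of_nonneg_right hεr (pow_nonneg (eta_pos Kt j).le 3)
  have hsub : Node00.regMSCoPOfRecord F 2 {ν with εreg := εr} Kt (k i) s.Ω ⊆ Node00.regMSCoPOfRecord F 2 {ν with εreg := ε₀} Kt (k i) s.Ω :=
    regMSCoPOfRecord_mono_eps ν Kt (k i) s.Ω hr₀.le
  have hcl : closure (Node00.regMSCoPOfRecord F 2 {ν with εreg := εr} Kt (k i) s.Ω) ⊆ Node00.regMSCoPOfRecord F 2 {ν with εreg := ε₀} Kt (k i) s.Ω :=
    closure_regMSCoPOfRecord_subset_of_lt ν Kt (k i) s.Ω hr₀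
  refine ⟨⟨Ustar, ?_⟩, ?_⟩
  · -- (E) at `εr`
    rw [hreg εr, hB]
    exact Node00.IsMinimizerB.of_subset_of_mem hsub hUr hUstar
  · -- (T1@q₀) at `εr`, for every minimiser `U₀`
    intro U₀ hU₀ U hU hUW hle
    rw [hreg εr, hB] at hU₀
    rw [hreg εr] at hU
    rw [hB] at hUW ⊢
    exact thm1RowB_of_existsUnique (Node00.avOfRecord F 2 Kt)
      (fun U₁ U₂ => ∃ u : GaugeTransf (F.P Kt) 0 SU2,
        (∀ j, j ≤ k i → ∀ b ∈ bd (k i) s.Ω j, toMS u j b.src = toMS u j b.tgt ∧ ∀ g : SU2, toMS u j b.src * g = g * toMS u j b.src) ∧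
          gaugeAct u U₁ = U₂)
      hsub hcl ⟨Ustar, hUstar, hUr⟩ huniq hU₀ U hU hUW hle

end AtZ

end Literature.MathematicalPhysics.QuantumFieldTheory.Balaban1983to89.B15Prop1Thm1RowsOfExistsUniqueAtLengthB

end
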